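import Literature.NumberTheory.Automorphic.VarmaTheorem1BaseChangeProofs
import Literature.NumberTheory.GaloisRepresentations.ArtinRestriction
import Literature.NumberTheory.EllipticCurves.GaloisActionProofs
import Literature.NumberTheory.EllipticCurves.Rank1Residual.Predicates
import Literature.NumberTheory.EllipticCurves.HeegnerPoints
import HarnessLib

/-!
# `E(K)[p] = 0` from a non-anomalous rational line at a place completely split in `K`
# (crux K4 `RedSplitControlAtThree`, item stmt-BirchSwinnertonDyer-24200, route `CumulativeHeegnerLeopoldt`)

Seat `bsd-line-chl-p2` g0 (cell `bsd-wall`, width prover on K4 under the lead `bsd-line-chl-p1`).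
HONEST FRAMING: unconditional tree lemmas (no named fact, no `sorry`); they close nothing by themselves;
BSD is not proved by any of this.

The Leopoldt cell of route `CumulativeHeegnerLeopoldt` replaces the onto-image hypothesis of UTD's control
crux #5 (`WildSplitControlAtThree`, 20386) by «`E[3]` reducible with a rational line `Φ` that is
NON-ANOMALOUS at every decomposition group `D_𝔓`, `𝔓 ∣ 3`» (neither `D_𝔓` fixes `Φ` pointwise nor acts
trivially on `E[3]/Φ`, the Castella–Grossi–Skinner hypothesis `φ|_{G_p} ≠ 1, ω`). The K1 door
`AdditivePotSupersingularControl.additiveControlOnTreeAt_of_classO6_of_facts` consumes the image hypothesis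
only through `E(K)[3] = 0`. This file proves that input on the reducible cell:

* `fix_or_quot_of_fixed_point` — finite-group bookkeeping: in a `G`-module `M` of order `p²` with a
  `D`-stable subgroup `Φ` of order `p`, a non-zero `D`-fixed vector forces `D` to fix `Φ` pointwise or to
  act trivially on `M/Φ`.
* `forall_nsmul_eq_zero_of_nonAnomalousLine` — for `W/ℚ` elliptic, `K/ℚ` finite Galois, `v` a finite
  place of `ℚ` COMPLETELY SPLIT in `K` (`e = f = 1`) and a rational line `Φ ⊂ E[p]` non-anomalous at every
  `𝔓 ∣ v`: `E(K)[p] = 0` (in the `•`-form `∀ x, p • x = 0 → x = 0`). Proof: a `K`-rational `p`-torsion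
  point gives a `Γ_K`-fixed `Q ∈ E[p](ℚ̄)`; `D_𝔓 ≤ res(Γ_K)` at a completely split place
  (`decompositionSubgroup_le_range_absGaloisRestrict`, Neukirch I (9.3)–(9.6)); so `D_𝔓` fixes `Q ≠ 0`,
  contradicting non-anomaly by the bookkeeping lemma (`#E[p] = p²`, Silverman III.6.4(b)).
* `forall_nsmul_eq_zero_of_nonAnomalousLine_of_degreeOne` — the same keyed by a degree-one prime `𝔭` of
  `K` above `v` (the frame data `he`/`hf` of the route's control items);
* `forall_nsmul_eq_zero_of_nonAnomalousCell[_of_isImaginaryQuadratic]`,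
  `torsionBy_eq_bot_of_nonAnomalousCell_of_isImaginaryQuadratic` — the route's `hcell` binder shape
  (∃ Φ rational line, non-anomalous at every `𝔓` over every `v ∋ p`) ⟹ `E(K)[p] = 0` for `K` Galois /
  imaginary quadratic and `𝔭 ∋ p` of degree one.

References: [NeukirchANT1999] Ch. I §9 (9.3)–(9.6); [SilvermanAEC2009] III.6.4(b), VIII.§1;
[CastellaGrossiSkinner2025] Thm. A (hypothesis on φ); [GrossLMS1991] §2.
-/

noncomputable section

open scoped Classical NumberField

open WeierstrassCurve NumberField IsDedekindDomain Field
  Literature.NumberTheory.EllipticCurves Literature.NumberTheory.GaloisRepresentations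
  Literature.NumberTheory.EllipticCurves.Rank1Residual

set_option linter.dupNamespace false
set_option autoImplicit false

namespace Summit.BirchSwinnertonDyer.BirchSwinnertonDyer.Theorems.RedSplitControlAtThreeTorsionFree

/-! ## §1 Finite-group bookkeeping in a module of order `p²` -/

/-- **A fixed vector in a `p²`-module with a stable line.** Let `G` act on the abelian group `M` of order
`p²`, `Φ ≤ M` a subgroup of order `p` stable under the subgroup `D ≤ G`, and `Q ∈ M` a NON-ZERO vector
killed by `p` and fixed by every element of `D`. Then either `D` fixes `Φ` pointwise (`Q ∈ Φ` generates
`Φ`) or `D` acts trivially on `M/Φ` (`Q ∉ Φ`: `M = Φ ⊕ ℤQ`). Elementary (Lagrange in a group of order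
`p²`). [folklore] -/
theorem fix_or_quot_of_fixed_point {G M : Type*} [Group G] [AddCommGroup M] [DistribMulAction G M]
    {p : ℕ} (hp : p.Prime) (hM : Nat.card M = p ^ 2) (Φ : AddSubgroup M) (hΦ : Nat.card Φ = p)
    (D : Subgroup G) (hstab : ∀ g ∈ D, ∀ P ∈ Φ, g • P ∈ Φ)
    {Q : M} (hQ0 : Q ≠ 0) (hpQ : p • Q = 0) (hfix : ∀ g ∈ D, g • Q = Q) :
    (∀ g ∈ D, ∀ P ∈ Φ, g • P = P) ∨ (∀ g ∈ D, ∀ P : M, g • P - P ∈ Φ) := by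
  haveI : Finite M := Nat.finite_of_card_ne_zero (by rw [hM]; exact pow_ne_zero _ hp.ne_zero)
  by_cases hQΦ : Q ∈ Φ
  · -- `Q` generates `Φ`, so `D` fixes `Φ` pointwise
    left
    have hle : AddSubgroup.zmultiples Q ≤ Φ := (AddSubgroup.zmultiples_le).mpr hQΦ
    have hordQ : addOrderOf Q = p := by
      rcases (Nat.dvd_prime hp).mp (addOrderOf_dvd_of_nsmul_eq_zero hpQ) with h1 | h1
      · exact absurd (AddMonoid.addOrderOf_eq_one_iff.mp h1) hQ0
      · exact h1
    have hcardQ : Nat.card (AddSubgroup.zmultiples Q) = p := by rw [Nat.card_zmultiples, hordQ]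
    have heq : AddSubgroup.zmultiples Q = Φ :=
      AddSubgroup.eq_of_le_of_card_ge hle (by rw [hΦ, hcardQ])
    intro g hg P hP
    rw [← heq, AddSubgroup.mem_zmultiples_iff] at hP
    obtain ⟨k, rfl⟩ := hP
    rw [smul_comm g k Q, hfix g hg]
  · -- `M = Φ + ℤQ`, so `D` acts trivially modulo `Φ`
    right
    set S : AddSubgroup M := Φ ⊔ AddSubgroup.zmultiples Q with hSdef
    have hS : S = ⊤ := by
      have h1 : Nat.card S ∣ p ^ 2 := hM ▸ AddSubgroup.card_addSubgroup_dvd_card S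
      have h2 : p ∣ Nat.card S := hΦ ▸ AddSubgroup.card_dvd_of_le (le_sup_left : Φ ≤ S)
      obtain ⟨i, hi, hcard⟩ := (Nat.dvd_prime_pow hp).mp h1
      interval_cases i
      · rw [hcard, pow_zero, Nat.dvd_one] at h2
        exact absurd h2 hp.one_lt.ne'
      · exfalso
        apply hQΦ
        have hΦS : Φ = S :=
          AddSubgroup.eq_of_le_of_card_ge (le_sup_left : Φ ≤ S) (by rw [hcard, pow_one, hΦ])
        rw [hΦS]
        exact AddSubgroup.mem_sup_right (AddSubgroup.mem_zmultiples Q)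
      · exact (AddSubgroup.card_eq_iff_eq_top S).mp (by rw [hcard, hM])
    intro g hg P
    have hP : P ∈ S := hS ▸ AddSubgroup.mem_top P
    obtain ⟨y, hy, z, hz, rfl⟩ := AddSubgroup.mem_sup.mp hP
    obtain ⟨k, rfl⟩ := AddSubgroup.mem_zmultiples_iff.mp hz
    have hcalc : g • (y + k • Q) - (y + k • Q) = g • y - y := by
      rw [smul_add, smul_comm g k Q, hfix g hg]
      abel
    rw [hcalc]
    exact Φ.sub_mem (hstab g hg y hy) hy

/-! ## §2 `E(K)[p] = 0` from a non-anomalous rational line at a completely split place -/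

variable {W : WeierstrassCurve ℚ} [W.IsElliptic] {p : ℕ} [Fact p.Prime]

/-- **`E(K)[p] = 0` from a non-anomalous rational line at a place completely split in `K`.** Let `W/ℚ`
be an elliptic curve, `K/ℚ` a finite Galois extension, `v` a finite place of `ℚ` with
`e(v, K) = f(v, K) = 1`, and `Φ ⊂ E[p](ℚ̄)` a rational line (order `p`, `Γ_ℚ`-stable) such that for
every prime `𝔓 ∣ v` of `\bar ℤ` the decomposition group `D_𝔓 ≤ Γ_ℚ` neither fixes `Φ` pointwise nor acts
trivially on `E[p]/Φ`. Then `E(K)` has no point of order `p`: a `K`-rational `p`-torsion point is fixed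
by `res(Γ_K) ⊇ D_𝔓` (Neukirch I (9.3)–(9.6), `decompositionSubgroup_le_range_absGaloisRestrict`), and a
non-zero `D_𝔓`-fixed vector of `E[p]` (order `p²`, Silverman III.6.4(b)) contradicts non-anomaly
(`fix_or_quot_of_fixed_point`). [cite: NeukirchANT1999, Ch. I §9 (9.3)–(9.6)]
[cite: SilvermanAEC2009, Cor. III.6.4(b)] [cite: CastellaGrossiSkinner2025, Thm. A (hypothesis on φ)] -/
theorem forall_nsmul_eq_zero_of_nonAnomalousLine (K : Type) [Field K] [NumberField K] [IsGalois ℚ K]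
    {v : HeightOneSpectrum (𝓞 ℚ)} (he : v.asIdeal.ramificationIdxIn (𝓞 K) = 1)
    (hf : v.asIdeal.inertiaDegIn (𝓞 K) = 1)
    {Φ : AddSubgroup (geomTorsion W (p : ℤ))} (hΦ : IsRationalLine W p Φ)
    (hna : ∀ 𝔓 ∈ v.primesAbove,
      ¬ (∀ g ∈ 𝔓.decompositionSubgroup (absoluteGaloisGroup ℚ), ∀ P ∈ Φ, g • P = P) ∧
      ¬ (∀ g ∈ 𝔓.decompositionSubgroup (absoluteGaloisGroup ℚ), ∀ P : geomTorsion W (p : ℤ),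
        g • P - P ∈ Φ)) :
    ∀ x : (W.baseChange K).toAffine.Point, p • x = 0 → x = 0 := by
  intro x hx
  by_contra hx0
  have hp : p.Prime := Fact.out
  obtain ⟨𝔓, h𝔓⟩ := HeightOneSpectrum.primesAbove_nonempty v
  have hD := decompositionSubgroup_le_range_absGaloisRestrict ℚ K he hf h𝔓
  obtain ⟨e, hrange⟩ := exists_mem_range_absGaloisRestrict_iff ℚ K
  -- the point over `ℚ̄`
  let φ : (W.baseChange K).toAffine.Point →+ geomPoints W := WeierstrassCurve.Affine.Point.map e
  have hφ : Function.Injective φ := WeierstrassCurve.Affine.Point.map_injective _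
  have hQ0' : φ x ≠ 0 := fun h => hx0 (hφ (by rw [h, map_zero]))
  have hQp' : p • φ x = 0 := by rw [← map_nsmul, hx, map_zero]
  let Q : geomTorsion W (p : ℤ) := ⟨φ x, AddSubgroup.torsionBy.nsmul_iff.mpr hQp'⟩
  have hQ0 : Q ≠ 0 := fun h => hQ0' (congrArg Subtype.val h)
  have hpQ : p • Q = 0 := Subtype.ext hQp'
  -- `Q` is fixed by the decomposition group `D_𝔓 ≤ res(Γ_K)`
  have hfix : ∀ g ∈ 𝔓.decompositionSubgroup (absoluteGaloisGroup ℚ), g • Q = Q := by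
    intro g hg
    have hg' : ∀ y : K, g • e y = e y := (hrange g).mp (hD hg)
    apply Subtype.ext
    have hcomp : (absoluteGaloisGroup.toAlgEquiv ℚ g).toAlgHom.comp e = e := AlgHom.ext fun y => hg' y
    change WeierstrassCurve.Affine.Point.map (absoluteGaloisGroup.toAlgEquiv ℚ g).toAlgHom
        (WeierstrassCurve.Affine.Point.map e x) = WeierstrassCurve.Affine.Point.map e x
    rw [WeierstrassCurve.Affine.Point.map_map, hcomp]
  -- `#E[p] = p²`
  have hM : Nat.card (geomTorsion W (p : ℤ)) = p ^ 2 :=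
    WeierstrassCurve.card_torsionPoints_eq_sq_holds W (AlgebraicClosure ℚ) (n := p)
      (by exact_mod_cast hp.ne_zero)
  have hstab : ∀ g ∈ 𝔓.decompositionSubgroup (absoluteGaloisGroup ℚ), ∀ P ∈ Φ, g • P ∈ Φ :=
    fun g _ P hP => hΦ.2 g P hP
  rcases fix_or_quot_of_fixed_point hp hM Φ hΦ.1 _ hstab hQ0 hpQ hfix with h | h
  · exact (hna 𝔓 h𝔓).1 h
  · exact (hna 𝔓 h𝔓).2 h

/-- **The same, keyed by a degree-one prime of `K`.** For `K/ℚ` finite Galois and a prime `𝔭` of `𝓞_K`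
with `e(𝔭|v) = f(𝔭|v) = 1` over the place `v` of `ℚ` below it (so `v` is completely split in `K`), a
rational line `Φ ⊂ E[p]` non-anomalous at every `𝔓 ∣ v` forces `E(K)[p] = 0`. (In a Galois extension
`e`, `f` do not depend on the prime above `v`: Mathlib `Ideal.ramificationIdxIn_eq_ramificationIdx`.)
[cite: NeukirchANT1999, Ch. I §9 (9.3)–(9.6)] [cite: SilvermanAEC2009, Cor. III.6.4(b)] -/
theorem forall_nsmul_eq_zero_of_nonAnomalousLine_of_degreeOne (K : Type) [Field K] [NumberField K]
    [IsGalois ℚ K] {v : HeightOneSpectrum (𝓞 ℚ)} (𝔭 : HeightOneSpectrum (𝓞 K))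
    (hv : 𝔭.asIdeal.under (𝓞 ℚ) = v.asIdeal)
    (he : 𝔭.asIdeal.ramificationIdx (𝓞 ℚ) = 1) (hf : 𝔭.asIdeal.inertiaDeg (𝓞 ℚ) = 1)
    {Φ : AddSubgroup (geomTorsion W (p : ℤ))} (hΦ : IsRationalLine W p Φ)
    (hna : ∀ 𝔓 ∈ v.primesAbove,
      ¬ (∀ g ∈ 𝔓.decompositionSubgroup (absoluteGaloisGroup ℚ), ∀ P ∈ Φ, g • P = P) ∧
      ¬ (∀ g ∈ 𝔓.decompositionSubgroup (absoluteGaloisGroup ℚ), ∀ P : geomTorsion W (p : ℤ),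
        g • P - P ∈ Φ)) :
    ∀ x : (W.baseChange K).toAffine.Point, p • x = 0 → x = 0 := by
  haveI : 𝔭.asIdeal.IsPrime := 𝔭.isPrime
  haveI : 𝔭.asIdeal.LiesOver v.asIdeal := ⟨hv.symm⟩
  haveI : Module.Finite (𝓞 ℚ) (𝓞 K) := IsIntegralClosure.finite (𝓞 ℚ) ℚ K (𝓞 K)
  haveI : IsGaloisGroup (K ≃ₐ[ℚ] K) (𝓞 ℚ) (𝓞 K) :=
    IsGaloisGroup.of_isFractionRing (K ≃ₐ[ℚ] K) (𝓞 ℚ) (𝓞 K) ℚ K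
  have he' : v.asIdeal.ramificationIdxIn (𝓞 K) = 1 := by
    rw [Ideal.ramificationIdxIn_eq_ramificationIdx v.asIdeal 𝔭.asIdeal (K ≃ₐ[ℚ] K)]; exact he
  have hf' : v.asIdeal.inertiaDegIn (𝓞 K) = 1 := by
    rw [Ideal.inertiaDegIn_eq_inertiaDeg v.asIdeal 𝔭.asIdeal (K ≃ₐ[ℚ] K)]; exact hf
  exact forall_nsmul_eq_zero_of_nonAnomalousLine K he' hf' hΦ hna

/-! ## §3 The cell form: the hypothesis `hcell` of the route's K-items -/

/-- **`E(K)[p] = 0` on the non-anomalous reducible cell (the `hcell` binder of route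
`CumulativeHeegnerLeopoldt`)**: for `K/ℚ` finite Galois, a degree-one prime `𝔭 ∋ p` of `𝓞_K`
(`e(𝔭|p) = f(𝔭|p) = 1`), and the cell hypothesis «∃ rational line `Φ ⊂ E[p]` such that at every place
`v ∋ p` of `ℚ` and every `𝔓 ∣ v`, `D_𝔓` neither fixes `Φ` nor acts trivially on `E[p]/Φ`»:
`∀ x ∈ E(K), p • x = 0 → x = 0`. [cite: NeukirchANT1999, Ch. I §9 (9.3)–(9.6)]
[cite: SilvermanAEC2009, Cor. III.6.4(b)] [cite: CastellaGrossiSkinner2025, Thm. A (hypothesis on φ)] -/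
theorem forall_nsmul_eq_zero_of_nonAnomalousCell (K : Type) [Field K] [NumberField K] [IsGalois ℚ K]
    (𝔭 : HeightOneSpectrum (𝓞 K)) (h𝔭 : ((p : ℕ) : 𝓞 K) ∈ 𝔭.asIdeal)
    (he : 𝔭.asIdeal.ramificationIdx (𝓞 ℚ) = 1) (hf : 𝔭.asIdeal.inertiaDeg (𝓞 ℚ) = 1)
    (hcell : ∃ Φ : AddSubgroup (geomTorsion W (p : ℤ)), IsRationalLine W p Φ ∧
      ∀ (v : HeightOneSpectrum (𝓞 ℚ)), ((p : ℕ) : 𝓞 ℚ) ∈ v.asIdeal → ∀ 𝔓 ∈ v.primesAbove,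
        ¬ (∀ g ∈ 𝔓.decompositionSubgroup (absoluteGaloisGroup ℚ), ∀ P ∈ Φ, g • P = P) ∧
        ¬ (∀ g ∈ 𝔓.decompositionSubgroup (absoluteGaloisGroup ℚ), ∀ P : geomTorsion W (p : ℤ),
          g • P - P ∈ Φ)) :
    ∀ x : (W.baseChange K).toAffine.Point, p • x = 0 → x = 0 := by
  obtain ⟨Φ, hΦ, hna⟩ := hcell
  have hpv : ((p : ℕ) : 𝓞 ℚ) ∈ (𝔭.under (𝓞 ℚ)).asIdeal := by
    rw [HeightOneSpectrum.under_asIdeal, Ideal.under_def, Ideal.mem_comap, map_natCast]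
    exact h𝔭
  exact forall_nsmul_eq_zero_of_nonAnomalousLine_of_degreeOne K 𝔭 (v := 𝔭.under (𝓞 ℚ)) rfl he hf hΦ
    (hna _ hpv)

/-- **`E(K)[p] = 0` on the non-anomalous reducible cell over an imaginary quadratic `K`** (the shape
consumed by the additive K1 doors: `K` imaginary quadratic — only `[K : ℚ] = 2` is used, a quadratic
extension being Galois — and a degree-one prime `𝔭 ∋ p`). [cite: NeukirchANT1999, Ch. I §9 (9.3)–(9.6)]
[cite: SilvermanAEC2009, Cor. III.6.4(b)] [cite: GrossLMS1991, §2] -/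
theorem forall_nsmul_eq_zero_of_nonAnomalousCell_of_isImaginaryQuadratic (K : Type) [Field K]
    [NumberField K] (hK : IsImaginaryQuadratic K)
    (𝔭 : HeightOneSpectrum (𝓞 K)) (h𝔭 : ((p : ℕ) : 𝓞 K) ∈ 𝔭.asIdeal)
    (he : 𝔭.asIdeal.ramificationIdx (𝓞 ℚ) = 1) (hf : 𝔭.asIdeal.inertiaDeg (𝓞 ℚ) = 1)
    (hcell : ∃ Φ : AddSubgroup (geomTorsion W (p : ℤ)), IsRationalLine W p Φ ∧
      ∀ (v : HeightOneSpectrum (𝓞 ℚ)), ((p : ℕ) : 𝓞 ℚ) ∈ v.asIdeal → ∀ 𝔓 ∈ v.primesAbove,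
        ¬ (∀ g ∈ 𝔓.decompositionSubgroup (absoluteGaloisGroup ℚ), ∀ P ∈ Φ, g • P = P) ∧
        ¬ (∀ g ∈ 𝔓.decompositionSubgroup (absoluteGaloisGroup ℚ), ∀ P : geomTorsion W (p : ℤ),
          g • P - P ∈ Φ)) :
    ∀ x : (W.baseChange K).toAffine.Point, p • x = 0 → x = 0 := by
  haveI : Algebra.IsQuadraticExtension ℚ K := { finrank_eq_two' := hK.1 }
  haveI : IsGalois ℚ K := inferInstance
  exact forall_nsmul_eq_zero_of_nonAnomalousCell K 𝔭 h𝔭 he hf hcell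

/-- **`E(K)[p]` is trivial on the non-anomalous reducible cell** (`AddSubgroup.torsionBy … p = ⊥` form of
`forall_nsmul_eq_zero_of_nonAnomalousCell_of_isImaginaryQuadratic`). [cite: GrossLMS1991, §2]
[cite: NeukirchANT1999, Ch. I §9 (9.3)–(9.6)] -/
theorem torsionBy_eq_bot_of_nonAnomalousCell_of_isImaginaryQuadratic (K : Type) [Field K]
    [NumberField K] (hK : IsImaginaryQuadratic K)
    (𝔭 : HeightOneSpectrum (𝓞 K)) (h𝔭 : ((p : ℕ) : 𝓞 K) ∈ 𝔭.asIdeal)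
    (he : 𝔭.asIdeal.ramificationIdx (𝓞 ℚ) = 1) (hf : 𝔭.asIdeal.inertiaDeg (𝓞 ℚ) = 1)
    (hcell : ∃ Φ : AddSubgroup (geomTorsion W (p : ℤ)), IsRationalLine W p Φ ∧
      ∀ (v : HeightOneSpectrum (𝓞 ℚ)), ((p : ℕ) : 𝓞 ℚ) ∈ v.asIdeal → ∀ 𝔓 ∈ v.primesAbove,
        ¬ (∀ g ∈ 𝔓.decompositionSubgroup (absoluteGaloisGroup ℚ), ∀ P ∈ Φ, g • P = P) ∧
        ¬ (∀ g ∈ 𝔓.decompositionSubgroup (absoluteGaloisGroup ℚ), ∀ P : geomTorsion W (p : ℤ),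
          g • P - P ∈ Φ)) :
    AddSubgroup.torsionBy (W.baseChange K).toAffine.Point (p : ℤ) = ⊥ := by
  rw [eq_bot_iff]
  intro x hx
  rw [AddSubgroup.mem_bot]
  exact forall_nsmul_eq_zero_of_nonAnomalousCell_of_isImaginaryQuadratic K hK 𝔭 h𝔭 he hf hcell x
    (AddSubgroup.torsionBy.nsmul_iff.mp hx)

end Summit.BirchSwinnertonDyer.BirchSwinnertonDyer.Theorems.RedSplitControlAtThreeTorsionFree

end
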